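import Literature.MathematicalPhysics.QuantumFieldTheory.Balaban1983to89.B11Eq103H1Complex
import Mathlib.Analysis.InnerProductSpace.Projection.Basic
import HarnessLib

/-!
# Route `UnitScaleTilt`, crux K1 «MinimiserStabilityRegPr» (stmt-QuantumFields-19200), EX row `hGF[Lift]` (curved member) — **LOD LINE, PEN (L5″) FILE 2g (ABSTRACT):
# PRINT'S PROJECTOR `R = projR Δ Q′` ((3.21)) IS COVARIANT UNDER ANY ISOMETRY INTERTWINING `Δ` AND THE CONSTRAINT KERNELS — `projR Δ′ Q′ (Φg) = Φ(projR Δ Q g)`,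
# hence `‖Φg − projR Δ′ Q′(Φg)‖ = ‖g − projR Δ Q g‖`: the `P`-term of the curved `flat_coercive_R_T3` is a GAUGE INVARIANT of the pair `(U₀, A)`**

Cell `ym3-torus` (HUMAN RULING D-0037, YM ladder rung R3 — NOT d = 4, NOT infinite volume, NOT a mass gap, NOT Clay).  Width seat `ym-routeR-w3` gen 12; ★p1 g24
LOCATE-L6-ASSEMBLY §1 Step I.2 (L5″), road (α) 2026-08-29 23:17:20Z: «`V := 1^{g̃⁻¹}` the pure gauge of a GLOBAL extension `g̃` of the axial gauge — so `P_V = Ad_{g̃}P_1Ad_{g̃}⁻¹`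
EXACTLY and globally … every covariance identity (`Δ^η`, `D`, `Q″`) is exact on the whole torus».  This file is that sentence for print's projector, ABSTRACTLY: Mathlib's
`Submodule.starProjection_map_apply` ∕ `Submodule.map_orthogonal_equiv` read on lit ✓`B11Eq103H1Complex.projR`.  THEOREMS ONLY (0 `def`, 0 `sorry`), Mathlib + lit `projR`;
`--supports stmt-QuantumFields-19200 --as helper`, count-neutral.  HONEST LABEL (★★OWNER RULING №33 (6)): curved γ-row supplier line (LOD localisation), pen (L5″); abstract
Hilbert-space algebra — the MEMBER instantiation (`Φ := Ad_σ` on `SiteL2K` as a linear isometry, `Δ := covLapSite U₀`, `Δ′ := covLapSite U₀^σ`, `Q, Q′ :=` the top nested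
covariant means of record at `U₀`, `U₀^σ`, intertwined by the coarse `Ad_{σ∘embIter}` via ✓`Prop8Chart.emlIterU_gaugeActT`) is a separate member file; nothing of (3.49), Thm 3.1∕3.3,
`h349`, `hGF`, EX ∕ 19200 is proved here.  Companion of ✓`Prop7LocalDivergenceComparison` §3 (the divergence term is a gauge invariant — px12 g13).

WHAT IS PROVED (ns `Summit.QuantumFields.YangMills.Theorems.Prop7ProjectorGaugeCovariance`; `E` a finite-dimensional inner-product space over `𝕜`, `Φ : E ≃ₗᵢ[𝕜] E`,
`Δ Δ′ : E →ₗ E` with `Δ′(Φx) = Φ(Δx)`, constraint maps `Q : E →ₗ F`, `Q′ : E →ₗ F′`).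
* §1 `ker_eq_map_of_conj` — a coarse intertwiner `Q′(Φx) = Θ(Qx)` (`Θ : F ≃ₗ F′`) gives `ker Q′ = (ker Q).map Φ`; `map_ker_map_eq` — then `(ker Q′).map Δ′ = ((ker Q).map Δ).map Φ`.
* §2 ★★ `projR_conj` — `projR Δ′ Q′ (Φ g) = Φ (projR Δ Q g)`; ★★ `sub_projR_conj` — `Φ g − projR Δ′ Q′ (Φ g) = Φ (g − projR Δ Q g)`; ★ `norm_projR_conj`, ★ `norm_sub_projR_conj`
  (the norms agree).
* §3 ★★★ `norm_sub_projR_adjoint_conj` — with a divergence pair `D†′(ΨA) = Φ(D†A)` (`Ψ` ANY map on the vector fields; member: `Ad_σ` on bonds, ✓`toL2S_symm_DstarL2_gaugeAct_conj`):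
  **`‖D†′(ΨA) − projR Δ′ Q′ (D†′(ΨA))‖ = ‖D†A − projR Δ Q (D†A)‖`** — the `P`-term `‖P(D*_UA)‖` of Organisation I (`‖Rf‖² = ‖f‖² − ‖Pf‖²`) is a gauge invariant of `(U₀, A)`,
  so Step I.2 (L5″) may pass from `U₀` to `U₀^{g̃}` (δ-close to `1` on the cube) at no cost, exactly as (L5b) does for `‖D*_UA‖`.

References: T. Bałaban, CMP **99** (1985) 389–434 [Balaban1985BackgroundPropagators] ((3.20)–(3.23) p.394, p.393 «all the operators … are covariant with respect to gauge
transformations»); CMP **98** (1985) 17–51 [Balaban1985Averaging] ((11) p.19, covariance of the averaging).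
-/

set_option autoImplicit false

noncomputable section

open scoped InnerProductSpace

namespace Summit.QuantumFields.YangMills.Theorems.Prop7ProjectorGaugeCovariance

open Literature.MathematicalPhysics.QuantumFieldTheory.Balaban1983to89.B11Eq103H1Complex (projR)

variable {𝕜 : Type*} [RCLike 𝕜] {E : Type*} [NormedAddCommGroup E] [InnerProductSpace 𝕜 E] [FiniteDimensional 𝕜 E]
  {F F' : Type*} [AddCommGroup F] [Module 𝕜 F] [AddCommGroup F'] [Module 𝕜 F']

/-! ## §1 Kernels and their images under an intertwining isometry -/

omit [FiniteDimensional 𝕜 E] in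
/-- **A COARSE INTERTWINER TRANSPORTS THE CONSTRAINT KERNEL**: `Q′(Φx) = Θ(Qx)` for a linear bijection `Θ` of the coarse spaces gives `ker Q′ = (ker Q).map Φ` — at the member
`Θ = Ad_{σ∘embIter (K−n)}` on the coarse sections ([Balaban1985Averaging] (11)). [cite: Balaban1985Averaging, (11) p.19] -/
theorem ker_eq_map_of_conj (Φ : E ≃ₗᵢ[𝕜] E) (Q : E →ₗ[𝕜] F) (Q' : E →ₗ[𝕜] F') (Θ : F ≃ₗ[𝕜] F') (hQ : ∀ x, Q' (Φ x) = Θ (Q x)) :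
    LinearMap.ker Q' = (LinearMap.ker Q).map (Φ.toLinearEquiv : E →ₗ[𝕜] E) := by
  ext x
  rw [Submodule.mem_map, LinearMap.mem_ker]
  constructor
  · intro hx
    refine ⟨Φ.symm x, ?_, ?_⟩
    · rw [LinearMap.mem_ker]
      have h := hQ (Φ.symm x)
      rw [LinearIsometryEquiv.apply_symm_apply, hx] at h
      exact Θ.injective (by rw [← h, map_zero])
    · simp
  · rintro ⟨y, hy, rfl⟩
    rw [LinearMap.mem_ker] at hy
    have hc : (Φ.toLinearEquiv : E →ₗ[𝕜] E) y = Φ y := rfl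
    rw [hc, hQ, hy, map_zero]

omit [FiniteDimensional 𝕜 E] in
/-- **THE PROJECTED SUBSPACES CORRESPOND**: `Δ′∘Φ = Φ∘Δ` and `ker Q′ = (ker Q).map Φ` give `(ker Q′).map Δ′ = ((ker Q).map Δ).map Φ` (print's `Δ_{U^σ}N(Q′_{U^σ}) = Ad_σ(Δ_UN(Q′_U))`).
[cite: Balaban1985BackgroundPropagators, (3.21) p.394, p.393] -/
theorem map_ker_map_eq (Φ : E ≃ₗᵢ[𝕜] E) (Δ Δ' : E →ₗ[𝕜] E) (hΔ : ∀ x, Δ' (Φ x) = Φ (Δ x)) (Q : E →ₗ[𝕜] F) (Q' : E →ₗ[𝕜] F')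
    (hker : LinearMap.ker Q' = (LinearMap.ker Q).map (Φ.toLinearEquiv : E →ₗ[𝕜] E)) :
    (LinearMap.ker Q').map Δ' = ((LinearMap.ker Q).map Δ).map (Φ.toLinearEquiv : E →ₗ[𝕜] E) := by
  rw [hker, ← Submodule.map_comp, ← Submodule.map_comp]
  congr 1
  ext x
  simpa using hΔ x

/-! ## §2 Covariance of print's projector `R = projR Δ Q′` -/

/-- ★★ **COVARIANCE OF (3.21)**: `projR Δ′ Q′ (Φ g) = Φ (projR Δ Q g)` whenever `Δ′∘Φ = Φ∘Δ` and `ker Q′ = (ker Q).map Φ` — the orthogonal projection onto the image of a subspace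
under a linear isometry is the conjugated projection (Mathlib `Submodule.starProjection_map_apply`). [cite: Balaban1985BackgroundPropagators, (3.21) p.394, p.393] -/
theorem projR_conj (Φ : E ≃ₗᵢ[𝕜] E) (Δ Δ' : E →ₗ[𝕜] E) (hΔ : ∀ x, Δ' (Φ x) = Φ (Δ x)) (Q : E →ₗ[𝕜] F) (Q' : E →ₗ[𝕜] F')
    (hker : LinearMap.ker Q' = (LinearMap.ker Q).map (Φ.toLinearEquiv : E →ₗ[𝕜] E)) (g : E) :
    projR Δ' Q' (Φ g) = Φ (projR Δ Q g) := by
  haveI : CompleteSpace ((LinearMap.ker Q).map Δ) := FiniteDimensional.complete 𝕜 _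
  haveI : CompleteSpace ((LinearMap.ker Q').map Δ') := FiniteDimensional.complete 𝕜 _
  haveI : CompleteSpace (((LinearMap.ker Q).map Δ).map (Φ.toLinearEquiv : E →ₗ[𝕜] E)) := FiniteDimensional.complete 𝕜 _
  have hmap := map_ker_map_eq Φ Δ Δ' hΔ Q Q' hker
  show (((LinearMap.ker Q').map Δ').starProjection : E →L[𝕜] E) (Φ g) = Φ ((((LinearMap.ker Q).map Δ).starProjection : E →L[𝕜] E) g)
  have h1 : (((LinearMap.ker Q').map Δ').starProjection : E →L[𝕜] E) (Φ g)
      = ((((LinearMap.ker Q).map Δ).map (Φ.toLinearEquiv : E →ₗ[𝕜] E)).starProjection : E →L[𝕜] E) (Φ g) := by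
    congr 2
  rw [h1, Submodule.starProjection_map_apply, LinearIsometryEquiv.symm_apply_apply]

/-- ★★ **COVARIANCE OF THE COMPLEMENTARY PROJECTOR `P = 1 − R`**: `Φ g − projR Δ′ Q′ (Φ g) = Φ (g − projR Δ Q g)`. [cite: Balaban1985BackgroundPropagators, (3.20)–(3.21) p.394] -/
theorem sub_projR_conj (Φ : E ≃ₗᵢ[𝕜] E) (Δ Δ' : E →ₗ[𝕜] E) (hΔ : ∀ x, Δ' (Φ x) = Φ (Δ x)) (Q : E →ₗ[𝕜] F) (Q' : E →ₗ[𝕜] F')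
    (hker : LinearMap.ker Q' = (LinearMap.ker Q).map (Φ.toLinearEquiv : E →ₗ[𝕜] E)) (g : E) :
    Φ g - projR Δ' Q' (Φ g) = Φ (g - projR Δ Q g) := by
  rw [projR_conj Φ Δ Δ' hΔ Q Q' hker g, map_sub]

/-- ★ `‖projR Δ′ Q′ (Φ g)‖ = ‖projR Δ Q g‖`. [cite: Balaban1985BackgroundPropagators, (3.21) p.394] -/
theorem norm_projR_conj (Φ : E ≃ₗᵢ[𝕜] E) (Δ Δ' : E →ₗ[𝕜] E) (hΔ : ∀ x, Δ' (Φ x) = Φ (Δ x)) (Q : E →ₗ[𝕜] F) (Q' : E →ₗ[𝕜] F')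
    (hker : LinearMap.ker Q' = (LinearMap.ker Q).map (Φ.toLinearEquiv : E →ₗ[𝕜] E)) (g : E) :
    ‖projR Δ' Q' (Φ g)‖ = ‖projR Δ Q g‖ := by
  rw [projR_conj Φ Δ Δ' hΔ Q Q' hker g, LinearIsometryEquiv.norm_map]

/-- ★ `‖Φ g − projR Δ′ Q′ (Φ g)‖ = ‖g − projR Δ Q g‖` — the `P`-term is invariant. [cite: Balaban1985BackgroundPropagators, (3.20)–(3.21) p.394] -/
theorem norm_sub_projR_conj (Φ : E ≃ₗᵢ[𝕜] E) (Δ Δ' : E →ₗ[𝕜] E) (hΔ : ∀ x, Δ' (Φ x) = Φ (Δ x)) (Q : E →ₗ[𝕜] F) (Q' : E →ₗ[𝕜] F')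
    (hker : LinearMap.ker Q' = (LinearMap.ker Q).map (Φ.toLinearEquiv : E →ₗ[𝕜] E)) (g : E) :
    ‖Φ g - projR Δ' Q' (Φ g)‖ = ‖g - projR Δ Q g‖ := by
  rw [sub_projR_conj Φ Δ Δ' hΔ Q Q' hker g, LinearIsometryEquiv.norm_map]

/-! ## §3 With the divergence: the `P`-term of Organisation I is a gauge invariant of `(U₀, A)` -/

/-- ★★★ **THE `P`-TERM IS A GAUGE INVARIANT**: if moreover the divergences are intertwined, `D†′(ΨA) = Φ(D†A)` for some map `Ψ` of the vector fields (member: `Ad_σ` on bonds,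
✓`Prop7LocalDivergenceComparison.toL2S_symm_DstarL2_gaugeAct_conj`), then **`‖D†′(ΨA) − projR Δ′ Q′ (D†′(ΨA))‖ = ‖D†A − projR Δ Q (D†A)‖`** and
`‖projR Δ′ Q′ (D†′(ΨA))‖ = ‖projR Δ Q (D†A)‖` — so in Step I.2 (L5″) one may replace `U₀` by `U₀^{g̃}` (δ-close to `1` on the cube) before comparing with the flat system.
[cite: Balaban1985BackgroundPropagators, (3.20)–(3.23) p.394, p.393] -/
theorem norm_sub_projR_adjoint_conj {W W' : Type*} (Φ : E ≃ₗᵢ[𝕜] E) (Δ Δ' : E →ₗ[𝕜] E) (hΔ : ∀ x, Δ' (Φ x) = Φ (Δ x)) (Q : E →ₗ[𝕜] F) (Q' : E →ₗ[𝕜] F')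
    (hker : LinearMap.ker Q' = (LinearMap.ker Q).map (Φ.toLinearEquiv : E →ₗ[𝕜] E)) (Dad : W → E) (Dad' : W' → E) (Ψ : W → W')
    (hD : ∀ A, Dad' (Ψ A) = Φ (Dad A)) (A : W) :
    ‖Dad' (Ψ A) - projR Δ' Q' (Dad' (Ψ A))‖ = ‖Dad A - projR Δ Q (Dad A)‖ ∧ ‖projR Δ' Q' (Dad' (Ψ A))‖ = ‖projR Δ Q (Dad A)‖ := by
  rw [hD]
  exact ⟨norm_sub_projR_conj Φ Δ Δ' hΔ Q Q' hker (Dad A), norm_projR_conj Φ Δ Δ' hΔ Q Q' hker (Dad A)⟩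

end Summit.QuantumFields.YangMills.Theorems.Prop7ProjectorGaugeCovariance

end
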